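import Summits.AtomisticToContinuum.HydrodynamicLimit.Theorems.DiffuseBackwardInfluence.Negative.TransferKernels

/-!
# `TransferIsometry` (support item stmt-AtomisticToContinuum-12951, route `CollisionIsometryCLT`):
# the frozen-geometry velocity transfer is a linear `ℓ²`-isometry whose rows have weight `3`

The route `CollisionIsometryCLT` types the velocity transfer of a window as a fold, over the
collisions of the Alexander construction started at `y`, of the velocity parts of the elastic
reflections `collidePair` taken at the realised pre-collisional positions
(the crux files' `let M`; restated definitionally as `DiffuseBackwardInfluenceNeg.transfer` in
`Theorems/DiffuseBackwardInfluence/Negative/TransferKernels.lean`, whose vocabulary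
`pre / pairsAt / step / colls / transfer` we reuse). The support item `TransferIsometry` asks that,
for every `σ, N, y, Δ`, the map `W ↦ M N y Δ W` be additive, homogeneous, preserve `∑ i, ‖W i‖²`, and
that every row have Frobenius weight `∑ k a, ‖M (e_k ⊗ e_a) i‖² = 3`.

Proof (CIP 1994 §4.2: the collision map is a linear isometry of velocity space).
* §1 `reflectVel n` is linear in the velocity pair (`reflectVel_add`, `reflectVel_const_smul`).
* §2 Hence one collision step at FIXED positions, `W ↦ (velocities of collidePair G i₀ j₀ (x, W))`,
  is additive, homogeneous and preserves `∑ ‖W i‖²` (energy conservation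
  `configEnergy_collidePair`); the same holds for the crux's `dite`-guarded step, and the three
  properties pass to any `List.foldl` of such steps (`foldl_l2_props`).
* §3 Row weight, for ANY additive homogeneous `ℓ²`-norm-preserving self-map `g` of `ι → ℝ^m`
  (`ι`, `m` finite; `rowWeight_eq_card`): transported to the Hilbert space
  `PiLp 2 (fun _ : ι => ℝ^m)` it is a linear isometry, hence (equal finite dimension) a linear
  isometry equivalence `L`; with the orthonormal vectors `e_{ka}`,
  `g(e_{ka}) i b = ⟪L e_{ka}, e_{ib}⟫ = ⟪e_{ka}, L⁻¹ e_{ib}⟫`, so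
  `∑_{k,a} (g(e_{ka}) i b)² = ‖L⁻¹ e_{ib}‖² = 1`, and summing over `b` gives `card m` (`= 3`).
* §4 The corollaries for `transfer σ N y Δ` and the deciding theorem `transferIsometry_proof`,
  which concludes the route decl BY NAME (the item's `let M` unfolds to `transfer`).

References: C. Cercignani, R. Illner, M. Pulvirenti, *The Mathematical Theory of Dilute Gases*
(1994), §4.2; I. Gallagher, L. Saint-Raymond, B. Texier, *From Newton to Boltzmann* (2013), §1.1,
§4.1; N. Simányi, D. Szász, Ann. of Math. 149 (1999) (products of collision reflections).
-/

noncomputable section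

namespace Summit.AtomisticToContinuum.HydrodynamicLimit.Theorems

open scoped BigOperators InnerProductSpace
open Literature.Analysis.FluidPDE
open Summit.AtomisticToContinuum.HydrodynamicLimit.Theorems.DiffuseBackwardInfluenceNeg
  (V3 Cfg pre pairsAt step colls transfer)

namespace TransferIsometry

/-! ## §1 The reflection law is linear in the velocity pair -/

section Reflect

variable {E : Type*} [NormedAddCommGroup E] [InnerProductSpace ℝ E]

/-- The elastic reflection law `reflectVel n` is additive in the velocity pair `(v, w)`. [folklore] -/
theorem reflectVel_add (n : E) (p q : E × E) :
    reflectVel n (p + q) = reflectVel n p + reflectVel n q := by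
  obtain ⟨v₁, w₁⟩ := p
  obtain ⟨v₂, w₂⟩ := q
  have h : ⟪v₁ + v₂ - (w₁ + w₂), n⟫_ℝ = ⟪v₁ - w₁, n⟫_ℝ + ⟪v₂ - w₂, n⟫_ℝ := by
    rw [← inner_add_left, add_sub_add_comm]
  simp only [reflectVel, Prod.mk_add_mk]
  rw [h, add_div, add_smul]
  congr 1 <;> abel

/-- The elastic reflection law `reflectVel n` is homogeneous in the velocity pair `(v, w)`. [folklore] -/
theorem reflectVel_const_smul (n : E) (c : ℝ) (p : E × E) :
    reflectVel n (c • p) = c • reflectVel n p := by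
  obtain ⟨v, w⟩ := p
  have h : ⟪c • v - c • w, n⟫_ℝ = c * ⟪v - w, n⟫_ℝ := by
    rw [← smul_sub, real_inner_smul_left]
  simp only [reflectVel, Prod.smul_mk]
  rw [h, mul_div_assoc, mul_smul, smul_sub, smul_add]

end Reflect

/-! ## §2 One collision step at fixed positions; folds of such steps -/

section Step

variable {X : Type*} {m : Type*} [Fintype m] {n : ℕ}

/-- The velocity of particle `i` after the collision of `(i₀, j₀)` at fixed positions `x`, as a
function of the velocity field `W`: the reflected pair at `j₀` and `i₀`, unchanged elsewhere. [folklore] -/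
theorem collidePair_vel_apply (G : Geometry m X) (x : Fin n → X) {i₀ j₀ : Fin n} (hij : i₀ ≠ j₀)
    (W : Fin n → EuclideanSpace ℝ m) (i : Fin n) :
    (collidePair G i₀ j₀ (fun j => (x j, W j)) i).2 =
      if i = j₀ then (reflectVel (G.sepVec (x i₀) (x j₀)) (W i₀, W j₀)).2
      else if i = i₀ then (reflectVel (G.sepVec (x i₀) (x j₀)) (W i₀, W j₀)).1 else W i := by
  by_cases hj : i = j₀
  · subst hj
    rw [if_pos rfl, collidePair_apply_right]
  by_cases hi : i = i₀
  · subst hi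
    rw [if_neg hj, if_pos rfl, collidePair_apply_left hij]
  · rw [if_neg hj, if_neg hi, collidePair_apply_of_ne hi hj]

/-- One collision step at fixed positions is additive in the velocity field. [folklore] -/
theorem collidePair_vel_add (G : Geometry m X) (x : Fin n → X) {i₀ j₀ : Fin n} (hij : i₀ ≠ j₀)
    (W₁ W₂ : Fin n → EuclideanSpace ℝ m) :
    (fun i => (collidePair G i₀ j₀ (fun j => (x j, (W₁ + W₂) j)) i).2) =
      (fun i => (collidePair G i₀ j₀ (fun j => (x j, W₁ j)) i).2) +
        fun i => (collidePair G i₀ j₀ (fun j => (x j, W₂ j)) i).2 := by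
  funext i
  simp only [Pi.add_apply, collidePair_vel_apply G x hij]
  split_ifs
  · rw [← Prod.snd_add, ← reflectVel_add, Prod.mk_add_mk]
  · rw [← Prod.fst_add, ← reflectVel_add, Prod.mk_add_mk]
  · rfl

/-- One collision step at fixed positions is homogeneous in the velocity field. [folklore] -/
theorem collidePair_vel_smul (G : Geometry m X) (x : Fin n → X) {i₀ j₀ : Fin n} (hij : i₀ ≠ j₀)
    (c : ℝ) (W : Fin n → EuclideanSpace ℝ m) :
    (fun i => (collidePair G i₀ j₀ (fun j => (x j, (c • W) j)) i).2) =
      c • fun i => (collidePair G i₀ j₀ (fun j => (x j, W j)) i).2 := by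
  funext i
  simp only [Pi.smul_apply, collidePair_vel_apply G x hij]
  split_ifs
  · rw [← Prod.smul_snd, ← reflectVel_const_smul, Prod.smul_mk]
  · rw [← Prod.smul_fst, ← reflectVel_const_smul, Prod.smul_mk]
  · rfl

/-- One collision step at fixed positions preserves `∑ i, ‖W i‖²` (conservation of kinetic energy,
`configEnergy_collidePair`). [folklore] -/
theorem sum_norm_sq_collidePair_vel (G : Geometry m X) (x : Fin n → X) {i₀ j₀ : Fin n}
    (hij : i₀ ≠ j₀) (W : Fin n → EuclideanSpace ℝ m) :
    ∑ i, ‖(collidePair G i₀ j₀ (fun j => (x j, W j)) i).2‖ ^ 2 = ∑ i, ‖W i‖ ^ 2 := by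
  have h := configEnergy_collidePair (G := G) hij (fun j => (x j, W j))
  unfold configEnergy at h
  exact mul_left_cancel₀ (inv_ne_zero two_ne_zero) h

/-- The crux's `dite`-guarded fold step — reflect the chosen incoming pair `h.some` of `P a` at the
positions `x a` if `P a` is nonempty, else do nothing — is additive, homogeneous and preserves
`∑ i, ‖W i‖²`, provided the chosen pair is a genuine pair (`h.some.1 ≠ h.some.2`). [folklore] -/
theorem dite_collide_step_props {α : Type*} (G : Geometry m X) (P : α → Set (Fin n × Fin n))
    (x : α → Fin n → X) (hP : ∀ a (h : (P a).Nonempty), h.some.1 ≠ h.some.2) (a : α) :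
    (∀ W₁ W₂ : Fin n → EuclideanSpace ℝ m,
        @dite (Fin n → EuclideanSpace ℝ m) (P a).Nonempty (Classical.propDecidable _)
            (fun h => fun i => (collidePair G h.some.1 h.some.2 (fun j => (x a j, (W₁ + W₂) j)) i).2)
            (fun _ => W₁ + W₂) =
          @dite (Fin n → EuclideanSpace ℝ m) (P a).Nonempty (Classical.propDecidable _)
              (fun h => fun i => (collidePair G h.some.1 h.some.2 (fun j => (x a j, W₁ j)) i).2)
              (fun _ => W₁) +
            @dite (Fin n → EuclideanSpace ℝ m) (P a).Nonempty (Classical.propDecidable _)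
              (fun h => fun i => (collidePair G h.some.1 h.some.2 (fun j => (x a j, W₂ j)) i).2)
              (fun _ => W₂)) ∧
      (∀ (c : ℝ) (W : Fin n → EuclideanSpace ℝ m),
        @dite (Fin n → EuclideanSpace ℝ m) (P a).Nonempty (Classical.propDecidable _)
            (fun h => fun i => (collidePair G h.some.1 h.some.2 (fun j => (x a j, (c • W) j)) i).2)
            (fun _ => c • W) =
          c • @dite (Fin n → EuclideanSpace ℝ m) (P a).Nonempty (Classical.propDecidable _)
            (fun h => fun i => (collidePair G h.some.1 h.some.2 (fun j => (x a j, W j)) i).2)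
            (fun _ => W)) ∧
      (∀ W : Fin n → EuclideanSpace ℝ m,
        ∑ i, ‖@dite (Fin n → EuclideanSpace ℝ m) (P a).Nonempty (Classical.propDecidable _)
            (fun h => fun i => (collidePair G h.some.1 h.some.2 (fun j => (x a j, W j)) i).2)
            (fun _ => W) i‖ ^ 2 = ∑ i, ‖W i‖ ^ 2) := by
  by_cases h : (P a).Nonempty
  · simp only [dif_pos h]
    exact ⟨fun W₁ W₂ => collidePair_vel_add G (x a) (hP a h) W₁ W₂,
      fun c W => collidePair_vel_smul G (x a) (hP a h) c W,
      fun W => sum_norm_sq_collidePair_vel G (x a) (hP a h) W⟩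
  · refine ⟨fun W₁ W₂ => ?_, fun c W => ?_, fun W => ?_⟩ <;> simp only [dif_neg h]

/-- Additivity, homogeneity and preservation of `∑ i, ‖W i‖²` pass from the steps `W ↦ f W a` to
the fold `W ↦ l.foldl f W`. [folklore] -/
theorem foldl_l2_props {ι α : Type*} [Fintype ι]
    (f : (ι → EuclideanSpace ℝ m) → α → (ι → EuclideanSpace ℝ m))
    (hf : ∀ a, (∀ W₁ W₂, f (W₁ + W₂) a = f W₁ a + f W₂ a) ∧
      (∀ (c : ℝ) W, f (c • W) a = c • f W a) ∧ (∀ W, ∑ i, ‖f W a i‖ ^ 2 = ∑ i, ‖W i‖ ^ 2))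
    (l : List α) :
    (∀ W₁ W₂, l.foldl f (W₁ + W₂) = l.foldl f W₁ + l.foldl f W₂) ∧
      (∀ (c : ℝ) W, l.foldl f (c • W) = c • l.foldl f W) ∧
      (∀ W, ∑ i, ‖l.foldl f W i‖ ^ 2 = ∑ i, ‖W i‖ ^ 2) := by
  induction l with
  | nil => exact ⟨fun _ _ => rfl, fun _ _ => rfl, fun _ => rfl⟩
  | cons a l ih =>
    obtain ⟨ha, hs, hn⟩ := hf a
    obtain ⟨iha, ihs, ihn⟩ := ih
    refine ⟨fun W₁ W₂ => ?_, fun c W => ?_, fun W => ?_⟩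
    · rw [List.foldl_cons, List.foldl_cons, List.foldl_cons, ha, iha]
    · rw [List.foldl_cons, List.foldl_cons, hs, ihs]
    · rw [List.foldl_cons, ihn, hn]

end Step

/-! ## §3 Row weight of a linear `ℓ²`-isometry of `ι → ℝ^m` -/

section RowWeight

/-- **Row weight of a linear `ℓ²`-isometry.** If `g : (ι → ℝ^m) → (ι → ℝ^m)` (`ι`, `m` finite) is
additive, homogeneous and preserves `∑ i, ‖W i‖²`, then for every `i`,
`∑ k a, ‖g (e_k ⊗ e_a) i‖² = card m`: a linear isometry of a finite-dimensional Hilbert space is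
unitary, so the `(i, b)`-rows of its matrix are unit vectors. [folklore] -/
theorem rowWeight_eq_card {ι m : Type*} [Fintype ι] [DecidableEq ι] [Fintype m] [DecidableEq m]
    (g : (ι → EuclideanSpace ℝ m) → (ι → EuclideanSpace ℝ m))
    (hadd : ∀ W₁ W₂, g (W₁ + W₂) = g W₁ + g W₂) (hsmul : ∀ (c : ℝ) W, g (c • W) = c • g W)
    (hnorm : ∀ W, ∑ i, ‖g W i‖ ^ 2 = ∑ i, ‖W i‖ ^ 2) (i : ι) :
    ∑ k, ∑ a, ‖g (Pi.single k (EuclideanSpace.single a (1 : ℝ))) i‖ ^ 2 = Fintype.card m := by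
  -- transport `g` to the Hilbert space `V = PiLp 2 (ι → ℝ^m)`
  let V := PiLp 2 (fun _ : ι => EuclideanSpace ℝ m)
  let Lₗ : V →ₗ[ℝ] V :=
    { toFun := fun W => WithLp.toLp 2 (g (WithLp.ofLp W))
      map_add' := fun W₁ W₂ => by rw [WithLp.ofLp_add, hadd, WithLp.toLp_add]
      map_smul' := fun c W => by rw [WithLp.ofLp_smul, hsmul, WithLp.toLp_smul, RingHom.id_apply] }
  have hLnorm : ∀ W : V, ‖Lₗ W‖ = ‖W‖ := fun W => by
    have h2 : ‖Lₗ W‖ ^ 2 = ‖W‖ ^ 2 := by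
      rw [PiLp.norm_sq_eq_of_L2, PiLp.norm_sq_eq_of_L2]
      exact hnorm (WithLp.ofLp W)
    rw [← Real.sqrt_sq (norm_nonneg (Lₗ W)), h2, Real.sqrt_sq (norm_nonneg W)]
  let Li : V →ₗᵢ[ℝ] V := { toLinearMap := Lₗ, norm_map' := hLnorm }
  let L : V ≃ₗᵢ[ℝ] V := Li.toLinearIsometryEquiv rfl
  -- the orthonormal vectors `e k a = e_k ⊗ e_a` and their coordinate functional
  let e : ι → m → V := fun k a => WithLp.toLp 2 (Pi.single k (EuclideanSpace.single a (1 : ℝ)))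
  have he : ∀ k a (Y : V), ⟪e k a, Y⟫_ℝ = Y k a := by
    intro k a Y
    rw [PiLp.inner_apply, Finset.sum_eq_single k]
    · simp [e, EuclideanSpace.inner_single_left]
    · intro j _ hj
      simp [e, Pi.single_eq_of_ne hj]
    · exact fun h => absurd (Finset.mem_univ k) h
  have hne : ∀ b, ‖e i b‖ = 1 := fun b => by
    show ‖(PiLp.single 2 i (EuclideanSpace.single b (1 : ℝ)) :
      PiLp 2 (fun _ : ι => EuclideanSpace ℝ m))‖ = 1
    rw [PiLp.norm_single, PiLp.norm_single, norm_one]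
  -- each `(i, b)`-row of the matrix of `g` is a unit vector
  have key : ∀ b : m, ∑ k, ∑ a, (g (Pi.single k (EuclideanSpace.single a (1 : ℝ))) i b) ^ 2 = 1 := by
    intro b
    have h1 : ∀ k a, g (Pi.single k (EuclideanSpace.single a (1 : ℝ))) i b =
        ⟪e k a, L.symm (e i b)⟫_ℝ := fun k a =>
      calc g (Pi.single k (EuclideanSpace.single a (1 : ℝ))) i b = (L (e k a)) i b := rfl
        _ = ⟪e i b, L (e k a)⟫_ℝ := (he i b (L (e k a))).symm
        _ = ⟪L (e k a), e i b⟫_ℝ := real_inner_comm _ _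
        _ = ⟪e k a, L.symm (e i b)⟫_ℝ := L.inner_map_eq_flip _ _
    simp_rw [h1, he]
    calc ∑ k, ∑ a, (L.symm (e i b)) k a ^ 2 = ∑ k, ‖(L.symm (e i b)) k‖ ^ 2 :=
          Finset.sum_congr rfl fun k _ => (EuclideanSpace.real_norm_sq_eq _).symm
      _ = ‖L.symm (e i b)‖ ^ 2 := (PiLp.norm_sq_eq_of_L2 _ _).symm
      _ = 1 := by rw [LinearIsometryEquiv.norm_map, hne, one_pow]
  -- sum the rows `(i, b)` over `b`
  calc ∑ k, ∑ a, ‖g (Pi.single k (EuclideanSpace.single a (1 : ℝ))) i‖ ^ 2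
        = ∑ k, ∑ a, ∑ b, (g (Pi.single k (EuclideanSpace.single a (1 : ℝ))) i b) ^ 2 := by
          simp_rw [EuclideanSpace.real_norm_sq_eq]
    _ = ∑ k, ∑ b, ∑ a, (g (Pi.single k (EuclideanSpace.single a (1 : ℝ))) i b) ^ 2 :=
          Finset.sum_congr rfl fun k _ => Finset.sum_comm
    _ = ∑ b, ∑ k, ∑ a, (g (Pi.single k (EuclideanSpace.single a (1 : ℝ))) i b) ^ 2 :=
          Finset.sum_comm
    _ = ∑ b : m, (1 : ℝ) := (Finset.sum_congr rfl fun b _ => key b)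
    _ = Fintype.card m := by simp

end RowWeight

/-! ## §4 The crux's transfer -/

section Transfer

variable (σ : ℝ) (N : ℕ) (y : Cfg N) (Δ : ℝ)

/-- The three `ℓ²` properties of the frozen-geometry velocity transfer `transfer σ N y Δ`
(the crux's `M N y Δ`): additive, homogeneous, `∑ i, ‖W i‖²`-preserving. [folklore] -/
theorem transfer_l2_props :
    (∀ W₁ W₂, transfer σ N y Δ (W₁ + W₂) = transfer σ N y Δ W₁ + transfer σ N y Δ W₂) ∧
      (∀ (c : ℝ) W, transfer σ N y Δ (c • W) = c • transfer σ N y Δ W) ∧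
      (∀ W, ∑ i, ‖transfer σ N y Δ W i‖ ^ 2 = ∑ i, ‖W i‖ ^ 2) :=
  foldl_l2_props (step σ N y)
    (dite_collide_step_props (Torus.geometry (Fin 3)) (pairsAt σ N y) (fun k j => (pre σ N y k j).1)
      (fun _ h => ne_of_lt (Alexander.mem_incomingPairs.1 h.some_mem).1))
    (List.range (colls σ N y Δ))

/-- The velocity transfer is additive. [folklore] -/
theorem transfer_add (W₁ W₂ : Fin (N + 1) → V3) :
    transfer σ N y Δ (W₁ + W₂) = transfer σ N y Δ W₁ + transfer σ N y Δ W₂ :=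
  (transfer_l2_props σ N y Δ).1 W₁ W₂

/-- The velocity transfer is homogeneous. [folklore] -/
theorem transfer_smul (c : ℝ) (W : Fin (N + 1) → V3) :
    transfer σ N y Δ (c • W) = c • transfer σ N y Δ W :=
  (transfer_l2_props σ N y Δ).2.1 c W

/-- The velocity transfer preserves the kinetic energy `∑ i, ‖W i‖²`. [folklore] -/
theorem sum_norm_sq_transfer (W : Fin (N + 1) → V3) :
    ∑ i, ‖transfer σ N y Δ W i‖ ^ 2 = ∑ i, ‖W i‖ ^ 2 :=
  (transfer_l2_props σ N y Δ).2.2 W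

/-- **Row budget of the velocity transfer**: every row has Frobenius weight
`∑ k, ‖M_ik‖_F² = ∑ k a, ‖M (e_k ⊗ e_a) i‖² = 3`. [folklore] -/
theorem rowWeight_transfer (i : Fin (N + 1)) :
    ∑ k : Fin (N + 1), ∑ a : Fin 3,
      ‖transfer σ N y Δ (Pi.single k (EuclideanSpace.single a (1 : ℝ))) i‖ ^ 2 = 3 := by
  have h := rowWeight_eq_card (transfer σ N y Δ) (transfer_add σ N y Δ) (transfer_smul σ N y Δ)
    (sum_norm_sq_transfer σ N y Δ) i
  rwa [Fintype.card_fin, Nat.cast_ofNat] at h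

end Transfer

end TransferIsometry

/-- **`TransferIsometry` holds** (support item stmt-AtomisticToContinuum-12951, route
`CollisionIsometryCLT`, concluded BY NAME): for every `σ, N, y, Δ` the frozen-geometry velocity
transfer `W ↦ M N y Δ W` is additive, homogeneous, preserves `∑ i, ‖W i‖²`, and every row has
Frobenius weight `3` (the item's `let M` is definitionally `DiffuseBackwardInfluenceNeg.transfer`).
[folklore] -/
theorem transferIsometry_proof :
    Summit.AtomisticToContinuum.HydrodynamicLimit.Theses.CollisionIsometryCLT.TransferIsometry := by
  intro σ M N y Δ
  exact ⟨TransferIsometry.transfer_add σ N y Δ, TransferIsometry.transfer_smul σ N y Δ,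
    TransferIsometry.sum_norm_sq_transfer σ N y Δ, TransferIsometry.rowWeight_transfer σ N y Δ⟩

end Summit.AtomisticToContinuum.HydrodynamicLimit.Theorems

end
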